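import Summits.CriticalPhenomena.PercolationContinuityZ3.Theorems.PercNearOneGluingNoHeavyQuantTorqueRoutes
import HarnessLib

/-!
# QUANT lane R8, T-DEC: AGGREGATE-ROUTE TORQUE CERTIFICATES ON `{0..6}` — one low atom split over three absorbers, two low atoms over five
# routes with a shared costly absorber, and the capacity tools of the assemblies (arm-1 gen 55, architect)

builds on p205010 (kernel theorem, internal audit signed; external expert review pending)

Support file (`--supports stmt-CriticalPhenomena-4575`), QUANT lane seat prim-quant-arm-1 (gen 55, architect); memo
`run/shared/lean/prim/quant/prim-quant-arm-1-g55/ARCH-G55.md`.  Theorems only, standard axioms, no sorries.  A second thin layer over arm-1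
g50's torque-cost criterion `LawDec.decAt_all_of_torqueCost` (`…QuantTorqueCost`) and g54's route bookkeeping (`…QuantTorqueRoutes`), written
for laws on `{0..6}` (the three-sibling forests of 2-chains; sums over `Finset.range 7` are expanded):

* **`decAt_all_of_split1`** (`2 < T ≤ 4`): the positive low atom `1` split as `x₁ + x₂ + x₃ = μ 1` over three prescribed absorbers
  `h₁, h₂, h₃`, each within capacity at the layer-free rate and each cost-safe per unit ⟹ DEC at every layer;
* **`decAt_all_of_split12`** (`4 < T < 6`): the low atoms `1 → {5, 6}` and `2 → {3, 4, 6}` with prescribed flows, the shared absorber `6`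
  loaded by both, one torque-cost inequality ⟹ DEC at every layer;
* tools: `exists_split3` (water-filling of one mass over three capacities), `freeRate_eq_of_le`, `freeRate_one_two`, `freeRate_one_three`
  (the exact rates of the routes `1 → 2`, `1 → 3` above their `T/6` thresholds), `cap_sixth`, `cap_one_two`, `cap_one_three` (capacity in
  units of low mass), `add_div_three`.  The water-filling form for two lows under Hall's conditions is `…QuantTorqueHall`.

HONEST STATUS.  Pure bookkeeping (sufficient conditions for the torque-cost criterion); `SiblingStep`, `GateStepN`, `LightResidDECOracle`,
`FarTreeRow` OPEN; RATE class (log\*) / honest sentence of `run/shared/lean/prim/quant/README.md` unchanged.  [this work].  Nothing here is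
cited as a published result.  The gluing rows served [cite: KozmaNitzan2024, Conjecture 3 (p. 15)]; product measure [cite: Grimmett1999, §1.3 p. 10].
-/

noncomputable section

open scoped BigOperators

namespace Summit.CriticalPhenomena.PercolationContinuityZ3.Theorems
namespace Quant
namespace LawDec

open Finset

/-! ### One low atom split over three absorbers -/

/-- **ONE LOW ATOM, THREE ROUTES (`2 < T ≤ 4` on `{0..6}`)**: the positive low atom `1` is split as `x₁ + x₂ + x₃ = μ 1` over three distinct
absorbers `h₁, h₂, h₃ ∈ {2..6}` (a route carrying positive flow must be compatible, `T < 1 + h`), each load within capacity at the layer-free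
rate and each route cost-safe per unit (`(h − T)·freeRate ≤ T − 1` on its flow when `h > T`) ⟹ DEC at every layer below the top. [this work] -/
theorem decAt_all_of_split1 (y : ℝ) (h₁ h₂ h₃ : ℕ) (x₁ x₂ x₃ : ℝ) (μ : ℕ → ℝ) (T : ℝ) (hy0 : 0 < y) (hy1 : y < 1)
    (hμ0 : ∀ h, 0 ≤ μ h) (hμM : ∀ h, 6 < h → μ h = 0) (hμ1 : ∑ h ∈ Finset.range (6 + 1), μ h = 1)
    (hT : ∑ h ∈ Finset.range (6 + 1), (h : ℝ) * μ h = T) (hT2 : 2 < T) (hT4 : T ≤ 4) (hta : y * ((6 : ℕ) : ℝ) ≤ T)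
    (hh₁ : 1 < h₁) (hh₁M : h₁ ≤ 6) (hh₂ : 1 < h₂) (hh₂M : h₂ ≤ 6) (hh₃ : 1 < h₃) (hh₃M : h₃ ≤ 6)
    (h12 : h₁ ≠ h₂) (h13 : h₁ ≠ h₃) (h23 : h₂ ≠ h₃)
    (hx₁ : 0 ≤ x₁) (hx₂ : 0 ≤ x₂) (hx₃ : 0 ≤ x₃) (hsum : x₁ + x₂ + x₃ = μ 1)
    (hc₁ : 0 < x₁ → T < 1 + (h₁ : ℝ)) (hc₂ : 0 < x₂ → T < 1 + (h₂ : ℝ)) (hc₃ : 0 < x₃ → T < 1 + (h₃ : ℝ))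
    (hcap₁ : freeRate y T 1 h₁ * x₁ ≤ μ h₁) (hcap₂ : freeRate y T 1 h₂ * x₂ ≤ μ h₂) (hcap₃ : freeRate y T 1 h₃ * x₃ ≤ μ h₃)
    (hcost₁ : T < (h₁ : ℝ) → ((h₁ : ℝ) - T) * (freeRate y T 1 h₁ * x₁) ≤ x₁ * (T - 1))
    (hcost₂ : T < (h₂ : ℝ) → ((h₂ : ℝ) - T) * (freeRate y T 1 h₂ * x₂) ≤ x₂ * (T - 1))
    (hcost₃ : T < (h₃ : ℝ) → ((h₃ : ℝ) - T) * (freeRate y T 1 h₃ * x₃) ≤ x₃ * (T - 1)) :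
    ∀ j', j' < 6 → DECAt y j' 6 μ := by
  have hT0 : 0 < T := by linarith
  -- the transport: the low atom `1` split three ways
  set F : ℕ → ℕ → ℝ := fun l h =>
    if l = 1 then (if h = h₁ then x₁ else 0) + (if h = h₂ then x₂ else 0) + (if h = h₃ then x₃ else 0) else 0 with hF
  -- the load of each absorber
  have hin : ∀ h, ∑ l ∈ Finset.range (6 + 1), freeRate y T l h * F l h
      = (if h = h₁ then freeRate y T 1 h₁ * x₁ else 0) + (if h = h₂ then freeRate y T 1 h₂ * x₂ else 0)
        + (if h = h₃ then freeRate y T 1 h₃ * x₃ else 0) := by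
    intro h
    rw [Finset.sum_eq_single 1]
    · simp only [hF, if_true]
      by_cases e1 : h = h₁
      · subst e1; simp [h12, h13]
      by_cases e2 : h = h₂
      · subst e2; simp [h23, Ne.symm h12]
      by_cases e3 : h = h₃
      · subst e3; simp [Ne.symm h13, Ne.symm h23]
      simp [e1, e2, e3]
    · intro l _ hl; simp [hF, hl]
    · intro hm; exact absurd (Finset.mem_range.2 (by omega)) hm
  refine decAt_all_of_torqueCost y 6 μ T F hy0 hy1 hμ0 hμM hμ1 hT hT0 hta ?_ ?_ ?_ ?_ ?_
  · intro l h
    simp only [hF]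
    split_ifs <;> linarith
  · intro l h hpos
    simp only [hF] at hpos
    by_cases hl : l = 1
    · subst hl
      rw [if_pos rfl] at hpos
      refine ⟨le_rfl, by push_cast; linarith, ?_, ?_, ?_⟩
      · by_contra hcon
        have hh : h ≤ 1 := by omega
        have e1 : h ≠ h₁ := by omega
        have e2 : h ≠ h₂ := by omega
        have e3 : h ≠ h₃ := by omega
        rw [if_neg e1, if_neg e2, if_neg e3] at hpos; linarith
      · by_contra hcon
        have e1 : h ≠ h₁ := by omega
        have e2 : h ≠ h₂ := by omega
        have e3 : h ≠ h₃ := by omega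
        rw [if_neg e1, if_neg e2, if_neg e3] at hpos; linarith
      · by_cases e1 : h = h₁
        · subst e1; rw [if_pos rfl, if_neg h12, if_neg h13, add_zero, add_zero] at hpos; push_cast; exact hc₁ hpos
        by_cases e2 : h = h₂
        · subst e2; rw [if_neg (Ne.symm h12), if_pos rfl, if_neg h23, zero_add, add_zero] at hpos; push_cast; exact hc₂ hpos
        by_cases e3 : h = h₃
        · subst e3; rw [if_neg (Ne.symm h13), if_neg (Ne.symm h23), if_pos rfl, zero_add, zero_add] at hpos; push_cast
          exact hc₃ hpos
        rw [if_neg e1, if_neg e2, if_neg e3] at hpos; linarith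
    · rw [if_neg hl] at hpos; exact absurd hpos (lt_irrefl 0)
  · intro l hl hlow
    by_cases hl1 : l = 1
    · subst hl1
      simp only [hF, if_true, Finset.sum_add_distrib]
      rw [Finset.sum_ite_eq' (Finset.range (6 + 1)) h₁, if_pos (Finset.mem_range.2 (by omega)),
        Finset.sum_ite_eq' (Finset.range (6 + 1)) h₂, if_pos (Finset.mem_range.2 (by omega)),
        Finset.sum_ite_eq' (Finset.range (6 + 1)) h₃, if_pos (Finset.mem_range.2 (by omega)), hsum]
    · exfalso
      have : (2 : ℝ) ≤ l := by exact_mod_cast (show 2 ≤ l by omega)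
      linarith
  · intro h _
    rw [hin h]
    by_cases e1 : h = h₁
    · subst e1; rw [if_pos rfl, if_neg h12, if_neg h13, add_zero, add_zero]; exact hcap₁
    by_cases e2 : h = h₂
    · subst e2; rw [if_neg (Ne.symm h12), if_pos rfl, if_neg h23, zero_add, add_zero]; exact hcap₂
    by_cases e3 : h = h₃
    · subst e3; rw [if_neg (Ne.symm h13), if_neg (Ne.symm h23), if_pos rfl, zero_add, zero_add]; exact hcap₃
    rw [if_neg e1, if_neg e2, if_neg e3, add_zero, add_zero]; exact hμ0 h
  · -- cost: route by route, each at most `x_k (T − 1)`, total `μ 1 (T − 1) ≤` budget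
    have hsplit : ∀ h : ℕ, (if T < (h : ℝ) then ((h : ℝ) - T) * ∑ l ∈ Finset.range (6 + 1),
        freeRate y T l h * F l h else 0)
        = (if T < (h : ℝ) then ((h : ℝ) - T) * (if h = h₁ then freeRate y T 1 h₁ * x₁ else 0) else 0)
          + (if T < (h : ℝ) then ((h : ℝ) - T) * (if h = h₂ then freeRate y T 1 h₂ * x₂ else 0) else 0)
          + (if T < (h : ℝ) then ((h : ℝ) - T) * (if h = h₃ then freeRate y T 1 h₃ * x₃ else 0) else 0) := by
      intro h; rw [hin h]; split_ifs <;> ring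
    have hone : ∀ (hk : ℕ) (xk : ℝ), hk ≤ 6 → 0 ≤ xk →
        (T < (hk : ℝ) → ((hk : ℝ) - T) * (freeRate y T 1 hk * xk) ≤ xk * (T - 1)) →
        ∑ h ∈ Finset.range (6 + 1), (if T < (h : ℝ) then ((h : ℝ) - T) * (if h = hk then freeRate y T 1 hk * xk else 0) else 0)
          ≤ xk * (T - 1) := by
      intro hk xk hkM hxk hck
      rw [Finset.sum_eq_single hk]
      · rw [if_pos rfl]
        split_ifs with hc
        · exact hck hc
        · exact mul_nonneg hxk (by linarith)
      · intro h _ hh; rw [if_neg hh, mul_zero, ite_self]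
      · intro hm; exact absurd (Finset.mem_range.2 (by omega)) hm
    have hR := budget_ge_one 6 μ T hμ0 (by omega) (by linarith)
    calc ∑ h ∈ Finset.range (6 + 1), (if T < (h : ℝ) then ((h : ℝ) - T) * ∑ l ∈ Finset.range (6 + 1),
            freeRate y T l h * F l h else 0)
        = ∑ h ∈ Finset.range (6 + 1), (if T < (h : ℝ) then ((h : ℝ) - T) * (if h = h₁ then freeRate y T 1 h₁ * x₁ else 0) else 0)
          + ∑ h ∈ Finset.range (6 + 1), (if T < (h : ℝ) then ((h : ℝ) - T) * (if h = h₂ then freeRate y T 1 h₂ * x₂ else 0) else 0)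
          + ∑ h ∈ Finset.range (6 + 1), (if T < (h : ℝ) then ((h : ℝ) - T) * (if h = h₃ then freeRate y T 1 h₃ * x₃ else 0) else 0) := by
          rw [← Finset.sum_add_distrib, ← Finset.sum_add_distrib]; exact Finset.sum_congr rfl fun h _ => hsplit h
      _ ≤ x₁ * (T - 1) + x₂ * (T - 1) + x₃ * (T - 1) :=
          add_le_add (add_le_add (hone h₁ x₁ hh₁M hx₁ hcost₁) (hone h₂ x₂ hh₂M hx₂ hcost₂)) (hone h₃ x₃ hh₃M hx₃ hcost₃)
      _ = μ 1 * (T - 1) := by rw [← hsum]; ring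
      _ ≤ _ := hR


/-! ### Two low atoms with a shared costly absorber -/

/-- **TWO LOW ATOMS, FIVE ROUTES (`4 < T < 6` on `{0..6}`)**: flows `x₁₅ + x₁₆ = μ 1`, `x₂₃ + x₂₄ + x₂₆ = μ 2` (the route `2 → 3` only while
`T < 5`), loads within capacity at the layer-free rates (absorber `6` shared), and the torque cost of the costly routes (`1 → 5` while `T < 5`;
`1 → 6`, `2 → 6`) at most the budget `Σ_{1 ≤ l < T} μ l·(T − l)` ⟹ DEC at every layer below the top. [this work] -/
theorem decAt_all_of_split12 (y : ℝ) (x₁₅ x₁₆ x₂₃ x₂₄ x₂₆ : ℝ) (μ : ℕ → ℝ) (T : ℝ) (hy0 : 0 < y) (hy1 : y < 1)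
    (hμ0 : ∀ h, 0 ≤ μ h) (hμM : ∀ h, 6 < h → μ h = 0) (hμ1 : ∑ h ∈ Finset.range (6 + 1), μ h = 1)
    (hT : ∑ h ∈ Finset.range (6 + 1), (h : ℝ) * μ h = T) (hT4 : 4 < T) (hT6 : T < 6) (hta : y * ((6 : ℕ) : ℝ) ≤ T)
    (h15 : 0 ≤ x₁₅) (h16 : 0 ≤ x₁₆) (h23 : 0 ≤ x₂₃) (h24 : 0 ≤ x₂₄) (h26 : 0 ≤ x₂₆)
    (hrow1 : x₁₅ + x₁₆ = μ 1) (hrow2 : x₂₃ + x₂₄ + x₂₆ = μ 2) (hc23 : 0 < x₂₃ → T < 5)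
    (hcap3 : freeRate y T 2 3 * x₂₃ ≤ μ 3) (hcap4 : freeRate y T 2 4 * x₂₄ ≤ μ 4) (hcap5 : freeRate y T 1 5 * x₁₅ ≤ μ 5)
    (hcap6 : freeRate y T 1 6 * x₁₆ + freeRate y T 2 6 * x₂₆ ≤ μ 6)
    (hcost : (if T < 5 then (5 - T) * (freeRate y T 1 5 * x₁₅) else 0)
        + (6 - T) * (freeRate y T 1 6 * x₁₆ + freeRate y T 2 6 * x₂₆)
        ≤ ∑ l ∈ Finset.range (6 + 1), (if (1 ≤ l ∧ (l : ℝ) < T) then μ l * (T - l) else 0)) :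
    ∀ j', j' < 6 → DECAt y j' 6 μ := by
  have hT0 : 0 < T := by linarith
  set F : ℕ → ℕ → ℝ := fun l h =>
    if l = 1 then (if h = 5 then x₁₅ else 0) + (if h = 6 then x₁₆ else 0)
    else if l = 2 then (if h = 3 then x₂₃ else 0) + (if h = 4 then x₂₄ else 0) + (if h = 6 then x₂₆ else 0) else 0 with hF
  -- loads
  have load : ∀ h, ∑ l ∈ Finset.range (6 + 1), freeRate y T l h * F l h
      = (if h = 5 then freeRate y T 1 5 * x₁₅ else 0) + (if h = 6 then freeRate y T 1 6 * x₁₆ else 0)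
        + (if h = 3 then freeRate y T 2 3 * x₂₃ else 0) + (if h = 4 then freeRate y T 2 4 * x₂₄ else 0)
        + (if h = 6 then freeRate y T 2 6 * x₂₆ else 0) := by
    intro h
    simp only [hF, Finset.sum_range_succ, Finset.sum_range_zero]
    norm_num
    by_cases e3 : h = 3
    · subst e3; norm_num
    by_cases e4 : h = 4
    · subst e4; norm_num
    by_cases e5 : h = 5
    · subst e5; norm_num
    by_cases e6 : h = 6
    · subst e6; norm_num
    simp [e3, e4, e5, e6]
  refine decAt_all_of_torqueCost y 6 μ T F hy0 hy1 hμ0 hμM hμ1 hT hT0 hta ?_ ?_ ?_ ?_ ?_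
  · intro l h; simp only [hF]; split_ifs <;> linarith
  · intro l h hpos
    simp only [hF] at hpos
    by_cases l1 : l = 1
    · subst l1; rw [if_pos rfl] at hpos
      by_cases e5 : h = 5
      · subst e5; exact ⟨le_rfl, by push_cast; linarith, by norm_num, by norm_num, by push_cast; linarith⟩
      by_cases e6 : h = 6
      · subst e6; exact ⟨le_rfl, by push_cast; linarith, by norm_num, by norm_num, by push_cast; linarith⟩
      rw [if_neg e5, if_neg e6] at hpos; linarith
    by_cases l2 : l = 2
    · subst l2; rw [if_neg (by norm_num), if_pos rfl] at hpos
      by_cases e3 : h = 3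
      · subst e3; rw [if_pos rfl, if_neg (by norm_num), if_neg (by norm_num), add_zero, add_zero] at hpos
        exact ⟨by norm_num, by push_cast; linarith, by norm_num, by norm_num, by push_cast; linarith [hc23 hpos]⟩
      by_cases e4 : h = 4
      · subst e4; exact ⟨by norm_num, by push_cast; linarith, by norm_num, by norm_num, by push_cast; linarith⟩
      by_cases e6 : h = 6
      · subst e6; exact ⟨by norm_num, by push_cast; linarith, by norm_num, by norm_num, by push_cast; linarith⟩
      rw [if_neg e3, if_neg e4, if_neg e6] at hpos; linarith
    rw [if_neg l1, if_neg l2] at hpos; exact absurd hpos (lt_irrefl 0)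
  · intro l hl hlow
    by_cases l1 : l = 1
    · subst l1; simp only [hF, Finset.sum_range_succ, Finset.sum_range_zero]; norm_num; linarith
    by_cases l2 : l = 2
    · subst l2; simp only [hF, Finset.sum_range_succ, Finset.sum_range_zero]; norm_num; linarith
    exfalso
    have : (3 : ℝ) ≤ l := by exact_mod_cast (show 3 ≤ l by omega)
    linarith
  · intro h hh
    rw [load h]
    interval_cases h
    · norm_num; exact hμ0 0
    · norm_num; exact hμ0 1
    · norm_num; exact hμ0 2
    · norm_num; exact hcap3
    · norm_num; exact hcap4
    · norm_num; exact hcap5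
    · norm_num; exact hcap6
  · have e : ∑ h ∈ Finset.range (6 + 1), (if T < (h : ℝ) then ((h : ℝ) - T) * ∑ l ∈ Finset.range (6 + 1), freeRate y T l h * F l h else 0)
        = (if T < 5 then (5 - T) * (freeRate y T 1 5 * x₁₅) else 0) + (6 - T) * (freeRate y T 1 6 * x₁₆ + freeRate y T 2 6 * x₂₆) := by
      simp only [load, Finset.sum_range_succ, Finset.sum_range_zero]
      norm_num
      rw [if_neg (by linarith : ¬ T < 3), if_neg (by linarith : ¬ T < 4), if_pos hT6]
      ring
    rw [e]; exact hcost


/-! ### Small tools for the assemblies -/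

/-- **water-filling of one mass over three capacities**: `0 ≤ m ≤ c₁ + c₂ + c₃` (all nonnegative) ⟹ a split `x₁ + x₂ + x₃ = m` with
`0 ≤ x_k ≤ c_k`. [this work] -/
theorem exists_split3 (m c₁ c₂ c₃ : ℝ) (hm : 0 ≤ m) (h₁ : 0 ≤ c₁) (h₂ : 0 ≤ c₂) (h₃ : 0 ≤ c₃) (hcap : m ≤ c₁ + c₂ + c₃) :
    ∃ x₁ x₂ x₃ : ℝ, 0 ≤ x₁ ∧ 0 ≤ x₂ ∧ 0 ≤ x₃ ∧ x₁ + x₂ + x₃ = m ∧ x₁ ≤ c₁ ∧ x₂ ≤ c₂ ∧ x₃ ≤ c₃ := by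
  rcases le_total m c₁ with hm₁ | hm₁
  · exact ⟨m, 0, 0, hm, le_rfl, le_rfl, by ring, hm₁, h₂, h₃⟩
  rcases le_total (m - c₁) c₂ with hm₂ | hm₂
  · exact ⟨c₁, m - c₁, 0, h₁, by linarith, le_rfl, by ring, le_rfl, hm₂, h₃⟩
  · exact ⟨c₁, c₂, m - c₁ - c₂, h₁, h₂, by linarith, by ring, le_rfl, le_rfl, by linarith⟩

/-- the layer-free rate when the floor is below the credit gate: `y ≤ ρ = (T − 2l)/(h − l)` ⟹ `freeRate = ρ/(1 − ρ)`. [this work] -/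
theorem freeRate_eq_of_le (y T : ℝ) (l h : ℕ) (hy : y ≤ (T - 2 * (l : ℝ)) / ((h : ℝ) - l)) :
    freeRate y T l h = (T - 2 * (l : ℝ)) / ((h : ℝ) - l) / (1 - (T - 2 * (l : ℝ)) / ((h : ℝ) - l)) := by
  unfold freeRate; rw [max_eq_right hy]

/-- the route `1 → 2` above `T = 12/5`: `y ≤ T − 2`, `T < 3` ⟹ `freeRate·(3 − T) = T − 2`. [this work] -/
theorem freeRate_one_two (y T : ℝ) (hy : y ≤ T - 2) (hT3 : T < 3) : freeRate y T 1 2 * (3 - T) = T - 2 := by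
  have e : (T - 2 * ((1 : ℕ) : ℝ)) / (((2 : ℕ) : ℝ) - (1 : ℕ)) = T - 2 := by push_cast; ring
  rw [freeRate_eq_of_le y T 1 2 (by rw [e]; exact hy), e]
  have h3 : (3 : ℝ) - T ≠ 0 := by intro h; linarith
  have e2 : (1 : ℝ) - (T - 2) = 3 - T := by ring
  rw [e2, div_mul_cancel₀ _ h3]

/-- the route `1 → 3` above `T = 3`: `y ≤ (T − 2)/2`, `T < 4` ⟹ `freeRate·(4 − T) = T − 2`. [this work] -/
theorem freeRate_one_three (y T : ℝ) (hy : y ≤ (T - 2) / 2) (hT4 : T < 4) : freeRate y T 1 3 * (4 - T) = T - 2 := by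
  have e : (T - 2 * ((1 : ℕ) : ℝ)) / (((3 : ℕ) : ℝ) - (1 : ℕ)) = (T - 2) / 2 := by push_cast; ring
  rw [freeRate_eq_of_le y T 1 3 (by rw [e]; exact hy), e]
  have h4 : (4 : ℝ) - T ≠ 0 := by intro h; linarith
  have e2 : (1 : ℝ) - (T - 2) / 2 = (4 - T) / 2 := by ring
  rw [e2, div_div_div_cancel_right₀ (two_ne_zero), div_mul_cancel₀ _ h4]


/-- **capacity at rate `≤ T/(6−T)`**: `r ≤ T/(6−T)`, `0 ≤ x ≤ (6−T)·m/T`, `0 < T < 6` ⟹ `r·x ≤ m`. [this work] -/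
theorem cap_sixth (r x m T : ℝ) (hr : r ≤ T / (6 - T)) (hx0 : 0 ≤ x) (hx : x ≤ (6 - T) * m / T) (hT0 : 0 < T) (hT6 : T < 6) :
    r * x ≤ m := by
  have h6 : 0 < 6 - T := by linarith
  have hκ0 : 0 ≤ T / (6 - T) := div_nonneg hT0.le h6.le
  calc r * x ≤ T / (6 - T) * x := mul_le_mul_of_nonneg_right hr hx0
    _ ≤ T / (6 - T) * ((6 - T) * m / T) := mul_le_mul_of_nonneg_left hx hκ0
    _ = m := by field_simp

/-- **capacity of the route `1 → 2` for `12/5 ≤ T ≤ 3`**: `0 ≤ x ≤ (3−T)·m/(T−2)` ⟹ `freeRate·x ≤ m` (and the route is idle at `T = 3`).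
[this work] -/
theorem cap_one_two (y x m T : ℝ) (hy0 : 0 < y) (hy1 : y < 1) (hy : y ≤ T - 2) (hT3 : T ≤ 3) (hx0 : 0 ≤ x)
    (hx : x ≤ (3 - T) * m / (T - 2)) (hm : 0 ≤ m) : freeRate y T 1 2 * x ≤ m := by
  rcases eq_or_lt_of_le hT3 with h3 | h3
  · have hx' : x ≤ 0 := by rw [h3] at hx; simpa using hx
    have : x = 0 := le_antisymm hx' hx0
    rw [this, mul_zero]; exact hm
  · have hr0 : 0 ≤ freeRate y T 1 2 := freeRate_nonneg y T 1 2 hy0 hy1 (by push_cast; linarith) (by norm_num) (by push_cast; linarith)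
    have hT2' : 0 < T - 2 := by linarith
    calc freeRate y T 1 2 * x ≤ freeRate y T 1 2 * ((3 - T) * m / (T - 2)) := mul_le_mul_of_nonneg_left hx hr0
      _ = (freeRate y T 1 2 * (3 - T)) * m / (T - 2) := by ring
      _ = m := by rw [freeRate_one_two y T hy h3]; field_simp

/-- **capacity of the route `1 → 3` for `3 ≤ T ≤ 4`**: `0 ≤ x ≤ (4−T)·m/(T−2)` ⟹ `freeRate·x ≤ m` (idle at `T = 4`). [this work] -/
theorem cap_one_three (y x m T : ℝ) (hy0 : 0 < y) (hy1 : y < 1) (hy : y ≤ (T - 2) / 2) (hT4 : T ≤ 4) (hx0 : 0 ≤ x)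
    (hx : x ≤ (4 - T) * m / (T - 2)) (hm : 0 ≤ m) : freeRate y T 1 3 * x ≤ m := by
  rcases eq_or_lt_of_le hT4 with h4 | h4
  · have hx' : x ≤ 0 := by rw [h4] at hx; simpa using hx
    have : x = 0 := le_antisymm hx' hx0
    rw [this, mul_zero]; exact hm
  · have hr0 : 0 ≤ freeRate y T 1 3 := freeRate_nonneg y T 1 3 hy0 hy1 (by push_cast; linarith) (by norm_num) (by push_cast; linarith)
    have hT2' : 0 < T - 2 := by linarith
    calc freeRate y T 1 3 * x ≤ freeRate y T 1 3 * ((4 - T) * m / (T - 2)) := mul_le_mul_of_nonneg_left hx hr0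
      _ = (freeRate y T 1 3 * (4 - T)) * m / (T - 2) := by ring
      _ = m := by rw [freeRate_one_three y T hy h4]; field_simp

/-- three capacities in units of low mass add up: `(u₁·m₁ + u₂·m₂ + u₃·m₃)/D` bounds. A convenience rewriting:
`a/D + b/D + c/D = (a + b + c)/D`. [this work] -/
theorem add_div_three (a b c D : ℝ) : a / D + b / D + c / D = (a + b + c) / D := by ring


end LawDec
end Quant
end Summit.CriticalPhenomena.PercolationContinuityZ3.Theorems
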